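import Literature.Probability.Percolation.TwoClusterGibbsSampler
import Literature.Probability.Percolation.GladkovZiminKernel
import Literature.Probability.Percolation.DecisionTreeWeightedMeasure
import Literature.Probability.Percolation.TwoSetExchange
import Literature.Probability.LatticeModels.ProdBernoulliWeightContinuity
import HarnessLib

/-!
# `NoHeavyLowerTail` (stmt-CriticalPhenomena-4575), four-point law: the CONDITIONAL Aas–Gladkov inequality — given that `d` is
# isolated from `a, b, c`: `[abc|d]·[a|b|c|d] ≥ [ab|c|d][ac|b|d] + [ab|c|d][a|bc|d] + [ac|b|d][a|bc|d]` (Gladkov–Zimin 2024 draft, Cor. 3.5)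

Support file (prover seat `prim-l12-p2`, gen 4; `--supports stmt-CriticalPhenomena-4575`).  No named facts, standard axioms; the
definitions (`M3Lab` = the poset `M₃` with its order, the integer certificate kernel `Kz`, the label `lab3`) are local bookkeeping.

STATEMENT (`condAG`): bond percolation `μ = prodBernoulli w`, arbitrary edge probabilities, finite vertex type, vertices `a,b,c,d`,
`D = {a↮d} ∩ {b↮d} ∩ {c↮d}`; Gladkov's three-point strong Harris–Kleitman inequality `P(abc)P(a|b|c) ≥ Σ P(ab|c)P(ac|b)` (tree:
`prodBernoulli_threePoint_strongHarris`) holds for the law of the clusters of `a, b, c` RESTRICTED to `D`: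
`μ(D∩ab|c)μ(D∩ac|b) + μ(D∩ab|c)μ(D∩a|bc) + μ(D∩ac|b)μ(D∩a|bc) ≤ μ(D∩abc)·μ(D∩a|b|c)` (cells as intersections of `openConn` events).
PROOF = Gladkov–Zimin §3.2 ("apply [BHK06]'s method to `S = {a,b,c}`, `T = {d}` … the poset `M₃` … Corollary 3.5"), assembled from
tree theorems: (1) `BHK2006_twoSetConditional_transfer` (van den Berg–Häggström–Kahn 2006 §2.1: the conditional law of `(C_S, C_T)`
given `{S ↮ T}` inherits every continuous inequality valid for all monotone images of product measures on finite cubes); (2) for such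
an image the `M₃`-label of `{a,b,c}` read off `C_S` is monotone, so Gladkov–Zimin Thm 2.3 (`DecisionTree.kernel_classMass_le`, here
lifted to `prodBernoulli` on any finite cube: `gz_labelClass_le`) with the kernel of their display (6) (exchange condition by `decide`)
gives the strong Harris–Kleitman inequality for the label masses (`m3_kernel_ineq`); (3) the transfer hypotheses (pairs at `d` of
weight `< 1`, `μ(D) > 0`) are removed by the closure principle in the weights and the degenerate case `d ∈ {a,b,c}`.
WHY HERE: this row (and its relabellings) is violated by every all-positive pseudo-law witness behind the "no law-level certificate
for the `H_{q+t}` apex-edge step" verdicts (prim-facecert gen 3), computed against dictionaries without conditional rows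
(memo prim-l12/prim-l12-p2/FINDING-g4-MINORS26-CLASSIFIED.md §5).
[cite: GladkovZimin2024HK, Cor. 3.5, Thm. 2.3]; [cite: VandenbergHaggstromKahn2005, §2.1 (Thm. 2.1 via Claim 2.5)]
-/

noncomputable section

open MeasureTheory Set
open Literature.Probability.LatticeModels
open Literature.Probability.Percolation
open Literature.Probability.Percolation.DecisionTree

namespace Summit.CriticalPhenomena.PercolationContinuityZ3.Theorems.CutVertexMinors

/-! ## The poset `M₃` and the Gladkov–Zimin certificate kernel -/

/-- The five labels of the partition lattice of three points: `bot = a|b|c`, `ab = ab|c`, `ac = ac|b`,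
`bc = a|bc`, `top = abc`. [cite: GladkovZimin2024HK, Fig. 4] -/
inductive M3Lab
  | bot | ab | ac | bc | top
  deriving DecidableEq, Fintype

namespace M3Lab

/-- The order of `M₃` as a Boolean test. [cite: GladkovZimin2024HK, Fig. 4] -/
def ble : M3Lab → M3Lab → Bool
  | bot, _ => true
  | _, top => true
  | ab, ab => true
  | ac, ac => true
  | bc, bc => true
  | _, _ => false

/-- The order of `M₃`. [cite: GladkovZimin2024HK, Fig. 4] -/
instance instLEM3 : LE M3Lab := ⟨fun x y => ble x y = true⟩

/-- The order of `M₃` is decidable. [folklore] -/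
instance instDecLEM3 (x y : M3Lab) : Decidable (x ≤ y) := inferInstanceAs (Decidable (ble x y = true))

/-- Unfolding of the order. [folklore] -/
theorem le_iff (x y : M3Lab) : x ≤ y ↔ ble x y = true := Iff.rfl

/-- Transitivity of the order of `M₃` (Boolean form). [folklore] -/
theorem ble_trans : ∀ x y z : M3Lab, ble x y = true → ble y z = true → ble x z = true := by decide

/-- `M₃` as a preorder. [cite: GladkovZimin2024HK, Fig. 4] -/
instance instPreorderM3 : Preorder M3Lab where
  le := (· ≤ ·)
  le_refl x := by cases x <;> rfl
  le_trans x y z h₁ h₂ := ble_trans x y z h₁ h₂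

/-- The certificate kernel of Gladkov–Zimin's display (6), as an integer matrix, with the sign convention of the
tree's `kernel_classMass_le` (`A = −A_GZ`). [cite: GladkovZimin2024HK, display (6)] -/
def Kz : M3Lab → M3Lab → ℤ
  | top, bot => -1
  | bot, top => -1
  | ab, ac => 1
  | ab, bc => 1
  | ac, ab => 1
  | ac, bc => 1
  | bc, ab => 1
  | bc, ac => 1
  | _, _ => 0

/-- The kernel `Kz` satisfies the Gladkov–Zimin exchange condition on `M₃` (finite check).
[cite: GladkovZimin2024HK, proof of Thm. 3.2] -/
theorem Kz_exch : ∀ x y z t : M3Lab, ble x y = true → ble z t = true → Kz x t + Kz y z ≤ Kz x z + Kz y t := by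
  decide

/-- The exchange condition for the real kernel `(Kz · ·)`. [cite: GladkovZimin2024HK, proof of Thm. 3.2] -/
theorem K_exch ⦃x y z t : M3Lab⦄ (hxy : x ≤ y) (hzt : z ≤ t) :
    (Kz x t : ℝ) + Kz y z ≤ Kz x z + Kz y t := by exact_mod_cast Kz_exch x y z t hxy hzt

/-- The five labels as a `Finset` literal. [folklore] -/
theorem mem_all (x : M3Lab) : x ∈ ({bot, ab, ac, bc, top} : Finset M3Lab) := by
  cases x <;> simp

end M3Lab

open M3Lab
open scoped Classical

/-! ## Gladkov–Zimin's kernel inequality for a product measure on an arbitrary finite cube -/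

/-- The `prodBernoulli` mass of a label class is the finitary class mass over all coordinates.
[cite: GladkovZimin2024HK, Def. 1.3] -/
private theorem real_labelClass_eq_classMass {β : Type*} [Fintype β] [DecidableEq β] (q : β → unitInterval)
    {κ : Type*} [DecidableEq κ] (lab : Set β → κ) (l : κ) :
    (prodBernoulli q).real {x | lab x = l} =
      classMass Finset.univ (fun i => (q i : ℝ)) (fun S : Finset β => lab ↑S) l := by
  have hdet : DeterminedBy {x : Set β | lab x = l} (↑(Finset.univ : Finset β) : Set β) := by
    rw [determinedBy_iff]
    intro ω ω' h
    rw [Finset.coe_univ, Set.inter_univ, Set.inter_univ] at h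
    rw [h]
  rw [prodBernoulli_real_eq_PrW q hdet (X := {S : Finset β | lab ↑S = l}) (fun S _ => Iff.rfl)]
  unfold PrW classMass
  rw [Finset.sum_filter]
  refine Finset.sum_congr rfl fun S _ => ?_
  by_cases h : lab ↑S = l
  · rw [Set.indicator_of_mem (show S ∈ {S : Finset β | lab ↑S = l} from h), if_pos h]
  · rw [Set.indicator_of_notMem (show S ∉ {S : Finset β | lab ↑S = l} from h), if_neg h]

/-- **Gladkov–Zimin Thm 2.3 for `prodBernoulli` on any finite cube.**  For a labelling `lab` of the cube by a
preorder, monotone under adding coordinates, a finite `t` containing all labels and a kernel `A` with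
`A a d + A b c ≤ A a c + A b d` (`a ≤ b`, `c ≤ d`): `Σ_{a,b∈t} A a b μ(lab=a)μ(lab=b) ≤ Σ_{a∈t} A a a μ(lab=a)`.
[cite: GladkovZimin2024HK, Thm. 2.3 — corollary, derived in this file] -/
theorem gz_labelClass_le {β : Type*} [Fintype β] (q : β → unitInterval) {κ : Type*} [Preorder κ]
    [DecidableEq κ] (lab : Set β → κ) (hlab : ∀ ⦃b b' : Set β⦄, b ⊆ b' → lab b ≤ lab b') (t : Finset κ)
    (ht : ∀ b, lab b ∈ t) (A : κ → κ → ℝ)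
    (hA : ∀ ⦃a b c d : κ⦄, a ≤ b → c ≤ d → A a d + A b c ≤ A a c + A b d) :
    ∑ l ∈ t, ∑ l' ∈ t, A l l' * ((prodBernoulli q).real {x | lab x = l} * (prodBernoulli q).real {x | lab x = l'}) ≤
      ∑ l ∈ t, A l l * (prodBernoulli q).real {x | lab x = l} := by
  classical
  simp only [real_labelClass_eq_classMass]
  exact kernel_classMass_le Finset.univ (fun i => (q i).2.1) (fun i => (q i).2.2)
    (fun S : Finset β => lab ↑S) (fun S T hST => hlab (Finset.coe_subset.2 hST)) t (fun S _ => ht _) A hA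

/-! ## The `M₃`-label of an edge set and the transferred inequality -/

universe u

variable {V : Type u}

/-- The `M₃`-label of the partition of `(a, b, c)` induced by an edge set `E`. [this work] -/
def lab3 (a b c : V) (E : Set (Sym2 V)) : M3Lab :=
  if (openGraph E).Reachable a b then (if (openGraph E).Reachable a c then M3Lab.top else M3Lab.ab)
  else if (openGraph E).Reachable a c then M3Lab.ac
  else if (openGraph E).Reachable b c then M3Lab.bc else M3Lab.bot

/-- `lab3` is monotone under enlarging the edge set. [this work] -/
theorem lab3_mono (a b c : V) {E E' : Set (Sym2 V)} (h : E ⊆ E') : lab3 a b c E ≤ lab3 a b c E' := by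
  have hle : openGraph E ≤ openGraph E' := BHK2006.openGraph_le h
  unfold lab3
  by_cases hab : (openGraph E).Reachable a b <;> by_cases hac : (openGraph E).Reachable a c <;>
    by_cases hbc : (openGraph E).Reachable b c <;>
    by_cases hab' : (openGraph E').Reachable a b <;> by_cases hac' : (openGraph E').Reachable a c <;>
    by_cases hbc' : (openGraph E').Reachable b c <;>
    simp only [hab, hac, hbc, hab', hac', hbc', if_true, if_false] <;>
    first | exact le_refl _ | (exact absurd (hab.mono hle) hab') | (exact absurd (hac.mono hle) hac') |
      (exact absurd (hbc.mono hle) hbc') | (exact absurd (hab'.symm.trans hac') hbc') |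
      (exact absurd (hab'.trans hbc') hac') | (exact absurd (hac'.trans hbc'.symm) hab') |
      (exact absurd (hab.symm.trans hac) hbc) | (exact absurd (hab.trans hbc) hac) |
      (exact absurd (hac.trans hbc.symm) hab) | decide

/-- **The strong Harris–Kleitman inequality for the `M₃`-label masses of ANY monotone image of a product
measure** (the hypothesis of the transfer principle): for `g : Set β → Set (Sym2 V) × Set (Sym2 V)` with
increasing first component and `m_l = μ_q{b | lab3 (g b).1 = l}`,
`m_ab m_ac + m_ab m_bc + m_ac m_bc ≤ m_top m_bot`. [cite: GladkovZimin2024HK, Thm. 2.3 and display (6)] -/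
theorem m3_kernel_ineq {β : Type u} [Fintype β] (q : β → unitInterval) (a b c : V)
    (g : Set β → Set (Sym2 V) × Set (Sym2 V)) (hg : ∀ x x', x ⊆ x' → (g x).1 ⊆ (g x').1) :
    (prodBernoulli q).real {x | lab3 a b c (g x).1 = M3Lab.ab} * (prodBernoulli q).real {x | lab3 a b c (g x).1 = M3Lab.ac} +
      (prodBernoulli q).real {x | lab3 a b c (g x).1 = M3Lab.ab} * (prodBernoulli q).real {x | lab3 a b c (g x).1 = M3Lab.bc} +
      (prodBernoulli q).real {x | lab3 a b c (g x).1 = M3Lab.ac} * (prodBernoulli q).real {x | lab3 a b c (g x).1 = M3Lab.bc} ≤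
    (prodBernoulli q).real {x | lab3 a b c (g x).1 = M3Lab.top} * (prodBernoulli q).real {x | lab3 a b c (g x).1 = M3Lab.bot} := by
  classical
  have key := gz_labelClass_le q (fun x => lab3 a b c (g x).1) (fun x x' h => lab3_mono a b c (hg x x' h))
    ({bot, ab, ac, bc, top} : Finset M3Lab) (fun x => mem_all _) (fun x y => (Kz x y : ℝ)) K_exch
  simp only [Finset.sum_insert, Finset.mem_insert, Finset.mem_singleton, Finset.sum_singleton, Kz, reduceCtorEq,
    or_self, not_false_eq_true, Int.cast_zero, Int.cast_one, Int.cast_neg, zero_mul, one_mul, neg_mul, zero_add,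
    add_zero] at key
  nlinarith [key]

/-! ## The conditional three-point strong Harris–Kleitman inequality -/

/-- Integral of a `0/1` function of a label. [folklore] -/
private theorem integral_ite_eq_real {Ω : Type*} [MeasurableSpace Ω] [MeasurableSingletonClass Ω] [Fintype Ω]
    (μ : Measure Ω) [IsFiniteMeasure μ] (p : Ω → Prop) [DecidablePred p] :
    ∫ x, (if p x then (1 : ℝ) else 0) ∂μ = μ.real {x | p x} := by
  have h : (fun x => if p x then (1 : ℝ) else 0) = Set.indicator {x | p x} 1 := by
    funext x
    by_cases hx : p x
    · rw [if_pos hx, Set.indicator_of_mem (show x ∈ {x | p x} from hx), Pi.one_apply]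
    · rw [if_neg hx, Set.indicator_of_notMem (show x ∉ {x | p x} from hx)]
  rw [h, integral_indicator_one (MeasurableSet.of_discrete)]

/-- Reachability between points of `S` is the same in `ω` and in the union `C_S(ω)` of their open edge
clusters. [folklore] -/
private theorem reachable_setCl_iff {S : Set V} {s v : V} (hs : s ∈ S) (ω : BondConfig V) :
    (openGraph (⋃ s ∈ S, openEdgeCluster ω s)).Reachable s v ↔ (openGraph ω).Reachable s v := by
  constructor
  · intro h
    exact h.mono (BHK2006.openGraph_le (Set.iUnion₂_subset fun s _ => openEdgeCluster_subset ω s))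
  · rintro ⟨p⟩
    have hp : ∀ e' ∈ p.edges, e' ∈ (openGraph (⋃ s ∈ S, openEdgeCluster ω s)).edgeSet := fun e' he' => by
      have h1 : e' ∈ openEdgeCluster ω s := TwoSetExchange.edge_mem_openEdgeCluster_of_walk p e' he'
      have h2 := ((mem_openEdgeCluster_iff ω s e').1 h1).2.1
      change e' ∈ (SimpleGraph.fromEdgeSet (⋃ s ∈ S, openEdgeCluster ω s)).edgeSet
      rw [SimpleGraph.edgeSet_fromEdgeSet]
      exact ⟨Set.mem_biUnion hs h1, h2⟩
    exact ⟨p.transfer _ hp⟩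

/-- The label of the true state `(C_S(ω), C_T(ω))`, `S = {a,b,c}`, is the label of `ω`. [this work] -/
private theorem lab3_setCl (a b c : V) (ω : BondConfig V) :
    lab3 a b c (⋃ s ∈ ({a, b, c} : Set V), openEdgeCluster ω s) = lab3 a b c ω := by
  have ha : a ∈ ({a, b, c} : Set V) := mem_insert a {b, c}
  have hb : b ∈ ({a, b, c} : Set V) := mem_insert_of_mem a (mem_insert b {c})
  unfold lab3
  simp only [reachable_setCl_iff ha, reachable_setCl_iff hb]

variable [Fintype V]

/-! ## Removing the transfer hypotheses (closure principle) and the cell form -/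

/-- **Conditional Aas–Gladkov inequality, label form** (Gladkov–Zimin 2024 draft, Cor. 3.5).
With `D = {a,b,c ↮ d}` and `m_l = μ(D ∩ {lab3 = l})`: `m_ab m_ac + m_ab m_bc + m_ac m_bc ≤ m_top m_bot` for EVERY weight
function (the transfer hypotheses are removed by continuity in the weights and the degenerate case `d ∈ {a,b,c}`).
[cite: GladkovZimin2024HK, Cor. 3.5 — corollary, derived in this file] -/
theorem condAG_lab (w : Sym2 V → unitInterval) (a b c d : V) :
    (prodBernoulli w).real ({ω : BondConfig V | ∀ s ∈ ({a, b, c} : Set V), ∀ t ∈ ({d} : Set V),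
        ¬ (openGraph ω).Reachable s t} ∩ {ω | lab3 a b c ω = M3Lab.ab}) *
      (prodBernoulli w).real ({ω : BondConfig V | ∀ s ∈ ({a, b, c} : Set V), ∀ t ∈ ({d} : Set V),
        ¬ (openGraph ω).Reachable s t} ∩ {ω | lab3 a b c ω = M3Lab.ac}) +
    (prodBernoulli w).real ({ω : BondConfig V | ∀ s ∈ ({a, b, c} : Set V), ∀ t ∈ ({d} : Set V),
        ¬ (openGraph ω).Reachable s t} ∩ {ω | lab3 a b c ω = M3Lab.ab}) *
      (prodBernoulli w).real ({ω : BondConfig V | ∀ s ∈ ({a, b, c} : Set V), ∀ t ∈ ({d} : Set V),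
        ¬ (openGraph ω).Reachable s t} ∩ {ω | lab3 a b c ω = M3Lab.bc}) +
    (prodBernoulli w).real ({ω : BondConfig V | ∀ s ∈ ({a, b, c} : Set V), ∀ t ∈ ({d} : Set V),
        ¬ (openGraph ω).Reachable s t} ∩ {ω | lab3 a b c ω = M3Lab.ac}) *
      (prodBernoulli w).real ({ω : BondConfig V | ∀ s ∈ ({a, b, c} : Set V), ∀ t ∈ ({d} : Set V),
        ¬ (openGraph ω).Reachable s t} ∩ {ω | lab3 a b c ω = M3Lab.bc}) ≤
    (prodBernoulli w).real ({ω : BondConfig V | ∀ s ∈ ({a, b, c} : Set V), ∀ t ∈ ({d} : Set V),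
        ¬ (openGraph ω).Reachable s t} ∩ {ω | lab3 a b c ω = M3Lab.top}) *
      (prodBernoulli w).real ({ω : BondConfig V | ∀ s ∈ ({a, b, c} : Set V), ∀ t ∈ ({d} : Set V),
        ¬ (openGraph ω).Reachable s t} ∩ {ω | lab3 a b c ω = M3Lab.bot}) := by
  classical
  set D : Set (BondConfig V) := {ω | ∀ s ∈ ({a, b, c} : Set V), ∀ t ∈ ({d} : Set V),
    ¬ (openGraph ω).Reachable s t} with hDdef
  by_cases hd : d = a ∨ d = b ∨ d = c
  · -- degenerate: `D = ∅`, every mass vanishes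
    have hDe : D = ∅ := by
      refine Set.eq_empty_iff_forall_notMem.2 fun ω hω => ?_
      rcases hd with h | h | h
      · subst h
        exact hω d (mem_insert d {b, c}) d (mem_singleton d) (SimpleGraph.Reachable.refl d)
      · subst h
        exact hω d (mem_insert_of_mem a (mem_insert d {c})) d (mem_singleton d) (SimpleGraph.Reachable.refl d)
      · subst h
        exact hω d (mem_insert_of_mem a (mem_insert_of_mem b (mem_singleton d))) d (mem_singleton d)
          (SimpleGraph.Reachable.refl d)
    simp only [hDe, empty_inter, measureReal_empty, mul_zero, add_zero, le_refl]
  simp only [not_or] at hd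
  obtain ⟨hda, hdb, hdc⟩ := hd
  -- non-degenerate placements: closure principle in the weights
  have hDne : D.Nonempty := by
    refine ⟨∅, fun s hs t ht hr => ?_⟩
    have hbot : openGraph (∅ : BondConfig V) = ⊥ := SimpleGraph.fromEdgeSet_empty
    rw [hbot, SimpleGraph.reachable_bot] at hr
    rw [mem_singleton_iff] at ht
    subst ht
    rcases hs with rfl | rfl | rfl
    · exact hda hr.symm
    · exact hdb hr.symm
    · exact hdc hr.symm
  refine weights_le_of_forall_pos_lt_one
    (f := fun p : Sym2 V → unitInterval =>
      (prodBernoulli p).real (D ∩ {ω | lab3 a b c ω = M3Lab.ab}) * (prodBernoulli p).real (D ∩ {ω | lab3 a b c ω = M3Lab.ac}) +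
      (prodBernoulli p).real (D ∩ {ω | lab3 a b c ω = M3Lab.ab}) * (prodBernoulli p).real (D ∩ {ω | lab3 a b c ω = M3Lab.bc}) +
      (prodBernoulli p).real (D ∩ {ω | lab3 a b c ω = M3Lab.ac}) * (prodBernoulli p).real (D ∩ {ω | lab3 a b c ω = M3Lab.bc}))
    (g := fun p : Sym2 V → unitInterval =>
      (prodBernoulli p).real (D ∩ {ω | lab3 a b c ω = M3Lab.top}) * (prodBernoulli p).real (D ∩ {ω | lab3 a b c ω = M3Lab.bot}))
    ?_ ?_ (fun p hp => ?_) w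
  · have c2 := prodBernoulli_real_continuous (ι := Sym2 V) (D ∩ {ω | lab3 a b c ω = M3Lab.ab})
    have c3 := prodBernoulli_real_continuous (ι := Sym2 V) (D ∩ {ω | lab3 a b c ω = M3Lab.ac})
    have c4 := prodBernoulli_real_continuous (ι := Sym2 V) (D ∩ {ω | lab3 a b c ω = M3Lab.bc})
    exact ((c2.mul c3).add (c2.mul c4)).add (c3.mul c4)
  · exact (prodBernoulli_real_continuous _).mul (prodBernoulli_real_continuous _)
  · have hT : ∀ e : Sym2 V, ¬ e.IsDiag → (∃ v ∈ e, v ∈ ({d} : Set V)) → (p e : ℝ) < 1 :=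
      fun e _ _ => unitInterval.coe_lt_one.2 (hp e).2
    have hD : 0 < (prodBernoulli p).real D := prodBernoulli_real_pos_of_nonempty hp hDne
    -- the inequality `m0 m1 - (m2 m3 + m2 m4 + m3 m4) ≥ 0` transferred
    have hP : Continuous fun m : Fin 5 → ℝ => m 0 * m 1 - (m 2 * m 3 + m 2 * m 4 + m 3 * m 4) := by continuity
    have key := BHK2006_twoSetConditional_transfer p ({a, b, c} : Set V) ({d} : Set V) hT hD
      ![fun x => if lab3 a b c x.1 = M3Lab.top then 1 else 0, fun x => if lab3 a b c x.1 = M3Lab.bot then 1 else 0,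
        fun x => if lab3 a b c x.1 = M3Lab.ab then 1 else 0, fun x => if lab3 a b c x.1 = M3Lab.ac then 1 else 0,
        fun x => if lab3 a b c x.1 = M3Lab.bc then 1 else 0] hP
      fun β _ q g hg => by
        have hg1 : ∀ x x', x ⊆ x' → (g x).1 ⊆ (g x').1 := fun x x' h => (hg x x' h).1
        have h := m3_kernel_ineq q a b c g hg1
        simp only [Matrix.cons_val_zero, Matrix.cons_val_one, Matrix.cons_val_two, Matrix.cons_val_three,
          Matrix.cons_val_four, Matrix.tail_cons, Matrix.head_cons, integral_ite_eq_real]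
        linarith
    simp only [Matrix.cons_val_zero, Matrix.cons_val_one, Matrix.cons_val_two, Matrix.cons_val_three,
      Matrix.cons_val_four, Matrix.tail_cons, Matrix.head_cons, lab3_setCl] at key
    -- the restricted integrals are the masses of `D ∩ {lab = l}`
    have hint : ∀ l : M3Lab, ∫ ω in D, (if lab3 a b c ω = l then (1 : ℝ) else 0) ∂(prodBernoulli p) =
        (prodBernoulli p).real (D ∩ {ω | lab3 a b c ω = l}) := by
      intro l
      have h : (fun ω : BondConfig V => if lab3 a b c ω = l then (1 : ℝ) else 0) =
          Set.indicator {ω | lab3 a b c ω = l} 1 := by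
        funext ω
        by_cases hω : lab3 a b c ω = l
        · rw [if_pos hω, Set.indicator_of_mem (show ω ∈ {ω | lab3 a b c ω = l} from hω), Pi.one_apply]
        · rw [if_neg hω, Set.indicator_of_notMem (show ω ∉ {ω | lab3 a b c ω = l} from hω)]
      rw [h, integral_indicator_one MeasurableSet.of_discrete, measureReal_restrict_apply MeasurableSet.of_discrete,
        inter_comm]
    rw [← hDdef] at key
    simp only [hint] at key
    -- clear denominators
    set Z := (prodBernoulli p).real D with hZ
    set m0 := (prodBernoulli p).real (D ∩ {ω | lab3 a b c ω = M3Lab.top})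
    set m1 := (prodBernoulli p).real (D ∩ {ω | lab3 a b c ω = M3Lab.bot})
    set m2 := (prodBernoulli p).real (D ∩ {ω | lab3 a b c ω = M3Lab.ab})
    set m3 := (prodBernoulli p).real (D ∩ {ω | lab3 a b c ω = M3Lab.ac})
    set m4 := (prodBernoulli p).real (D ∩ {ω | lab3 a b c ω = M3Lab.bc})
    have key' : 0 ≤ m0 / Z * (m1 / Z) - (m2 / Z * (m3 / Z) + m2 / Z * (m4 / Z) + m3 / Z * (m4 / Z)) := key
    have hZ2 : 0 < Z * Z := mul_pos hD hD
    have e : m0 / Z * (m1 / Z) - (m2 / Z * (m3 / Z) + m2 / Z * (m4 / Z) + m3 / Z * (m4 / Z)) =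
        (m0 * m1 - (m2 * m3 + m2 * m4 + m3 * m4)) / (Z * Z) := by
      field_simp
    rw [e] at key'
    have := (div_nonneg_iff.1 key').resolve_right (fun h => absurd h.2 (not_le.2 hZ2))
    linarith [this.1]

/-- **Conditional Aas–Gladkov inequality (cell form).**  For bond percolation with arbitrary edge probabilities on a
finite vertex type and vertices `a, b, c, d`, with `D = {a↮d} ∩ {b↮d} ∩ {c↮d}` ("`d` is isolated from `a, b, c`"):
`μ(D∩{a↔b}∩{a↮c})·μ(D∩{a↮b}∩{a↔c}) + μ(D∩{a↔b}∩{a↮c})·μ(D∩{a↮b}∩{a↮c}∩{b↔c}) + μ(D∩{a↮b}∩{a↔c})·μ(D∩{a↮b}∩{a↮c}∩{b↔c})`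
`≤ μ(D∩{a↔b}∩{a↔c}) · μ(D∩{a↮b}∩{a↮c}∩{b↮c})`,
i.e. `[ab|c|d][ac|b|d] + [ab|c|d][a|bc|d] + [ac|b|d][a|bc|d] ≤ [abc|d]·[a|b|c|d]`: Gladkov's three-point strong
Harris–Kleitman inequality for the law of the clusters of `a, b, c` CONDITIONED on `d` being joined to none of them.
[cite: GladkovZimin2024HK, Cor. 3.5 — corollary, derived in this file] -/
theorem condAG (w : Sym2 V → unitInterval) (a b c d : V) :
    (prodBernoulli w).real ((openConn a d)ᶜ ∩ (openConn b d)ᶜ ∩ (openConn c d)ᶜ ∩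
        (openConn a b ∩ (openConn a c)ᶜ)) *
      (prodBernoulli w).real ((openConn a d)ᶜ ∩ (openConn b d)ᶜ ∩ (openConn c d)ᶜ ∩
        ((openConn a b)ᶜ ∩ openConn a c)) +
    (prodBernoulli w).real ((openConn a d)ᶜ ∩ (openConn b d)ᶜ ∩ (openConn c d)ᶜ ∩
        (openConn a b ∩ (openConn a c)ᶜ)) *
      (prodBernoulli w).real ((openConn a d)ᶜ ∩ (openConn b d)ᶜ ∩ (openConn c d)ᶜ ∩
        ((openConn a b)ᶜ ∩ (openConn a c)ᶜ ∩ openConn b c)) +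
    (prodBernoulli w).real ((openConn a d)ᶜ ∩ (openConn b d)ᶜ ∩ (openConn c d)ᶜ ∩
        ((openConn a b)ᶜ ∩ openConn a c)) *
      (prodBernoulli w).real ((openConn a d)ᶜ ∩ (openConn b d)ᶜ ∩ (openConn c d)ᶜ ∩
        ((openConn a b)ᶜ ∩ (openConn a c)ᶜ ∩ openConn b c)) ≤
    (prodBernoulli w).real ((openConn a d)ᶜ ∩ (openConn b d)ᶜ ∩ (openConn c d)ᶜ ∩
        (openConn a b ∩ openConn a c)) *
      (prodBernoulli w).real ((openConn a d)ᶜ ∩ (openConn b d)ᶜ ∩ (openConn c d)ᶜ ∩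
        ((openConn a b)ᶜ ∩ (openConn a c)ᶜ ∩ (openConn b c)ᶜ)) := by
  have key := condAG_lab w a b c d
  have hD : {ω : BondConfig V | ∀ s ∈ ({a, b, c} : Set V), ∀ t ∈ ({d} : Set V), ¬ (openGraph ω).Reachable s t} =
      (openConn a d)ᶜ ∩ (openConn b d)ᶜ ∩ (openConn c d)ᶜ := by
    ext ω
    simp only [mem_insert_iff, mem_singleton_iff, forall_eq_or_imp, forall_eq, mem_setOf_eq, mem_inter_iff,
      mem_compl_iff, openConn, and_assoc]
  have E : ∀ (l : M3Lab) (X : Set (BondConfig V)),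
      (∀ ω : BondConfig V, ω ∈ X ↔ lab3 a b c ω = l) → {ω : BondConfig V | lab3 a b c ω = l} = X :=
    fun l X h => Set.ext fun ω => (h ω).symm
  have R : ∀ (ω : BondConfig V) (l : M3Lab), lab3 a b c ω = l ↔
      (if (openGraph ω).Reachable a b then (if (openGraph ω).Reachable a c then M3Lab.top else M3Lab.ab)
        else if (openGraph ω).Reachable a c then M3Lab.ac
        else if (openGraph ω).Reachable b c then M3Lab.bc else M3Lab.bot) = l := fun ω l => Iff.rfl
  have e_top := E M3Lab.top (openConn a b ∩ openConn a c) fun ω => by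
    rw [R]; by_cases h1 : (openGraph ω).Reachable a b <;> by_cases h2 : (openGraph ω).Reachable a c <;>
      by_cases h3 : (openGraph ω).Reachable b c <;> simp [h1, h2, h3, openConn]
  have e_ab := E M3Lab.ab (openConn a b ∩ (openConn a c)ᶜ) fun ω => by
    rw [R]; by_cases h1 : (openGraph ω).Reachable a b <;> by_cases h2 : (openGraph ω).Reachable a c <;>
      by_cases h3 : (openGraph ω).Reachable b c <;> simp [h1, h2, h3, openConn]
  have e_ac := E M3Lab.ac ((openConn a b)ᶜ ∩ openConn a c) fun ω => by
    rw [R]; by_cases h1 : (openGraph ω).Reachable a b <;> by_cases h2 : (openGraph ω).Reachable a c <;>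
      by_cases h3 : (openGraph ω).Reachable b c <;> simp [h1, h2, h3, openConn]
  have e_bc := E M3Lab.bc ((openConn a b)ᶜ ∩ (openConn a c)ᶜ ∩ openConn b c) fun ω => by
    rw [R]; by_cases h1 : (openGraph ω).Reachable a b <;> by_cases h2 : (openGraph ω).Reachable a c <;>
      by_cases h3 : (openGraph ω).Reachable b c <;> simp [h1, h2, h3, openConn]
  have e_bot := E M3Lab.bot ((openConn a b)ᶜ ∩ (openConn a c)ᶜ ∩ (openConn b c)ᶜ) fun ω => by
    rw [R]; by_cases h1 : (openGraph ω).Reachable a b <;> by_cases h2 : (openGraph ω).Reachable a c <;>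
      by_cases h3 : (openGraph ω).Reachable b c <;> simp [h1, h2, h3, openConn]
  rw [hD, e_top, e_ab, e_ac, e_bc, e_bot] at key
  exact key

end Summit.CriticalPhenomena.PercolationContinuityZ3.Theorems.CutVertexMinors
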